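import Mathlib
import HarnessLib
import Literature.MathematicalPhysics.StatisticalMechanics.RelevantHamiltonianStepOperator

/-!
# The coefficient space `M_0(𝓑_k)` of relevant Hamiltonians as a Banach space with the norm
# `‖·‖_{k,0}` ([ABKM19] (6.51)), and `A_k` as a continuous linear equivalence

[ABKM19] Ch. 12 runs the fine tuning on trajectories `(H_0, …, H_N)` of relevant Hamiltonians
measured by the scale-dependent coefficient norms `‖H‖_{k,0}` ((6.51), the tree's `hamNorm 𝔥 R n`
with `(𝔥, R, n) = (h_k L^{−k(d−2)/2}, L^k, L^{dk})`).  The tree's fine-tuning engine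
(`Literature.Dynamics.Hyperbolic.RGFlowStableManifoldReduced`) wants the relevant coordinates in
genuine Banach spaces `E k` and the steps `A_k : E k ≃L[ℝ] E (k+1)`.  This file provides them:

* `hamNorm_zero`, `hamNorm_add_le`, `hamNorm_real_smul`, `eq_zero_of_hamNorm_eq_zero` — `‖·‖_{k,0}`
  is a norm for positive weights;
* `HamSpace 𝕜 d 𝔥 R n` — a type synonym of `RelevantHamiltonian 𝕜 d` carrying the norm
  `hamNorm 𝔥 R n` (instances `NormedAddCommGroup`, `NormedSpace ℝ`, `FiniteDimensional`,
  `CompleteSpace`, under `Fact (0 < 𝔥)`, `Fact (0 < R)`, `Fact (0 < n)`); `HamSpace.norm_def`;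
* `stepOpA_real_smul`; **`stepOpAEquiv γ`** — `A_k^{(q)}` ((6.56)) as
  `HamSpace 𝕜 d 𝔥 R n ≃L[ℝ] HamSpace 𝕜 d 𝔥' R' n'` with inverse `stepOpAInv γ`;
  **`norm_stepOpAEquiv_symm_le`** — Lemma 10.5 (`‖A⁻¹‖ ≤ ¾`) in operator form.

Everything is proved; no named fact.

## References
* S. Adams, S. Buchholz, R. Kotecký, S. Müller, arXiv:1910.13564, Ch. 6.4 (6.51), Theorem 6.8
  (6.56), Lemma 10.5, Ch. 12 (12.1)–(12.2) [AdamsBuchholzKoteckyMuller2019].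
-/

noncomputable section

namespace Literature.MathematicalPhysics.StatisticalMechanics.GradientRG

open scoped BigOperators
open Finset

variable {𝕜 : Type*} [NormedField 𝕜] [NormedAlgebra ℝ 𝕜] {d : ℕ}

/-! ## `‖·‖_{k,0}` is a norm -/

omit [NormedAlgebra ℝ 𝕜] in
/-- `‖0‖_{k,0} = 0`. [cite: AdamsBuchholzKoteckyMuller2019, Ch. 6.4 (6.51)] -/
theorem hamNorm_zero (𝔥 R : ℝ) (n : ℕ) : hamNorm 𝔥 R n (0 : RelevantHamiltonian 𝕜 d) = 0 := by
  unfold hamNorm; simp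

omit [NormedAlgebra ℝ 𝕜] in
/-- Triangle inequality for `‖·‖_{k,0}` (`𝔥 ≥ 0`). [cite: AdamsBuchholzKoteckyMuller2019, Ch. 6.4 (6.51)] -/
theorem hamNorm_add_le {𝔥 R : ℝ} (h𝔥 : 0 ≤ 𝔥) (hR : 0 ≤ R) (n : ℕ) (H H' : RelevantHamiltonian 𝕜 d) :
    hamNorm 𝔥 R n (H + H') ≤ hamNorm 𝔥 R n H + hamNorm 𝔥 R n H' := by
  unfold hamNorm
  rw [← mul_add]
  refine mul_le_mul_of_nonneg_left ?_ (Nat.cast_nonneg n)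
  have h0 : ‖(H + H') (Sum.inl ())‖ ≤ ‖H (Sum.inl ())‖ + ‖H' (Sum.inl ())‖ := norm_add_le _ _
  have h1 : ∑ α : linIndex d, 𝔥 * (R ^ (∑ i, (α : Fin d → ℕ) i))⁻¹ * ‖(H + H') (Sum.inr (Sum.inl α))‖ ≤
      ∑ α : linIndex d, 𝔥 * (R ^ (∑ i, (α : Fin d → ℕ) i))⁻¹ * ‖H (Sum.inr (Sum.inl α))‖ +
        ∑ α : linIndex d, 𝔥 * (R ^ (∑ i, (α : Fin d → ℕ) i))⁻¹ * ‖H' (Sum.inr (Sum.inl α))‖ := by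
    rw [← Finset.sum_add_distrib]
    refine Finset.sum_le_sum fun α _ => ?_
    rw [← mul_add]
    refine mul_le_mul_of_nonneg_left (norm_add_le _ _) ?_
    exact mul_nonneg h𝔥 (inv_nonneg.2 (pow_nonneg hR _))
  have h2 : ∑ q : quadIndex d, (𝔥 / R) ^ 2 * ‖(H + H') (Sum.inr (Sum.inr q))‖ ≤
      ∑ q : quadIndex d, (𝔥 / R) ^ 2 * ‖H (Sum.inr (Sum.inr q))‖ +
        ∑ q : quadIndex d, (𝔥 / R) ^ 2 * ‖H' (Sum.inr (Sum.inr q))‖ := by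
    rw [← Finset.sum_add_distrib]
    refine Finset.sum_le_sum fun q _ => ?_
    rw [← mul_add]
    exact mul_le_mul_of_nonneg_left (norm_add_le _ _) (sq_nonneg _)
  linarith

/-- Absolute homogeneity for REAL scalars: `‖c • H‖_{k,0} = |c| ‖H‖_{k,0}`.
[cite: AdamsBuchholzKoteckyMuller2019, Ch. 6.4 (6.51)] -/
theorem hamNorm_real_smul (𝔥 R : ℝ) (n : ℕ) (c : ℝ) (H : RelevantHamiltonian 𝕜 d) :
    hamNorm 𝔥 R n (c • H) = |c| * hamNorm 𝔥 R n H := by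
  unfold hamNorm
  simp only [Pi.smul_apply, norm_smul, Real.norm_eq_abs]
  have e1 : ∑ α : linIndex d, 𝔥 * (R ^ (∑ i, (α : Fin d → ℕ) i))⁻¹ * (|c| * ‖H (Sum.inr (Sum.inl α))‖) =
      |c| * ∑ α : linIndex d, 𝔥 * (R ^ (∑ i, (α : Fin d → ℕ) i))⁻¹ * ‖H (Sum.inr (Sum.inl α))‖ := by
    rw [Finset.mul_sum]
    exact Finset.sum_congr rfl fun α _ => by ring
  have e2 : ∑ q : quadIndex d, (𝔥 / R) ^ 2 * (|c| * ‖H (Sum.inr (Sum.inr q))‖) =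
      |c| * ∑ q : quadIndex d, (𝔥 / R) ^ 2 * ‖H (Sum.inr (Sum.inr q))‖ := by
    rw [Finset.mul_sum]
    exact Finset.sum_congr rfl fun q _ => by ring
  rw [e1, e2]
  ring

omit [NormedAlgebra ℝ 𝕜] in
/-- **Definiteness**: for positive weights, `‖H‖_{k,0} = 0` forces `H = 0`.
[cite: AdamsBuchholzKoteckyMuller2019, Ch. 6.4 (6.51)] -/
theorem eq_zero_of_hamNorm_eq_zero {𝔥 R : ℝ} {n : ℕ} (h𝔥 : 0 < 𝔥) (hR : 0 < R) (hn : 0 < n)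
    {H : RelevantHamiltonian 𝕜 d} (h : hamNorm 𝔥 R n H = 0) : H = 0 := by
  unfold hamNorm at h
  have hn' : (0 : ℝ) < n := by exact_mod_cast hn
  have hsum := (mul_eq_zero.1 h).resolve_left hn'.ne'
  have hw : ∀ α : linIndex d, 0 < 𝔥 * (R ^ (∑ i, (α : Fin d → ℕ) i))⁻¹ :=
    fun α => mul_pos h𝔥 (inv_pos.2 (pow_pos hR _))
  have hq0 : 0 < (𝔥 / R) ^ 2 := pow_pos (div_pos h𝔥 hR) 2
  have t0 : 0 ≤ ‖H (Sum.inl ())‖ := norm_nonneg _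
  have t1 : 0 ≤ ∑ α : linIndex d, 𝔥 * (R ^ (∑ i, (α : Fin d → ℕ) i))⁻¹ * ‖H (Sum.inr (Sum.inl α))‖ :=
    Finset.sum_nonneg fun α _ => mul_nonneg (hw α).le (norm_nonneg _)
  have t2 : 0 ≤ ∑ q : quadIndex d, (𝔥 / R) ^ 2 * ‖H (Sum.inr (Sum.inr q))‖ :=
    Finset.sum_nonneg fun q _ => mul_nonneg hq0.le (norm_nonneg _)
  have e0 : ‖H (Sum.inl ())‖ = 0 := by linarith
  have e1 : ∑ α : linIndex d, 𝔥 * (R ^ (∑ i, (α : Fin d → ℕ) i))⁻¹ * ‖H (Sum.inr (Sum.inl α))‖ = 0 := by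
    linarith
  have e2 : ∑ q : quadIndex d, (𝔥 / R) ^ 2 * ‖H (Sum.inr (Sum.inr q))‖ = 0 := by linarith
  rw [Finset.sum_eq_zero_iff_of_nonneg (fun α _ => mul_nonneg (hw α).le (norm_nonneg _))] at e1
  rw [Finset.sum_eq_zero_iff_of_nonneg (fun q _ => mul_nonneg hq0.le (norm_nonneg _))] at e2
  funext ι
  rcases ι with u | α | q
  · cases u; exact norm_eq_zero.1 e0
  · exact norm_eq_zero.1 ((mul_eq_zero.1 (e1 α (Finset.mem_univ _))).resolve_left (hw α).ne')
  · exact norm_eq_zero.1 ((mul_eq_zero.1 (e2 q (Finset.mem_univ _))).resolve_left hq0.ne')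

/-! ## The Banach space `(M_0, ‖·‖_{k,0})` -/

/-- **The coefficient space of relevant Hamiltonians with the norm `‖·‖_{k,0}`** at the weights
`(𝔥, R, n)` ([ABKM19] (6.51); a type synonym of `RelevantHamiltonian 𝕜 d`, so that different scales
carry different norms). [cite: AdamsBuchholzKoteckyMuller2019, Ch. 6.4 (6.51)] -/
@[nolint unusedArguments]
def HamSpace (𝕜 : Type*) (d : ℕ) (_𝔥 _R : ℝ) (_n : ℕ) : Type _ := RelevantHamiltonian 𝕜 d

namespace HamSpace

variable {𝔥 R : ℝ} {n : ℕ}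

/-- The additive group of coefficient vectors (inherited from `RelIndex d → 𝕜`).
[cite: AdamsBuchholzKoteckyMuller2019, Ch. 6.4 (6.51)] -/
instance : AddCommGroup (HamSpace 𝕜 d 𝔥 R n) := inferInstanceAs (AddCommGroup (RelIndex d → 𝕜))

/-- The real vector space of coefficient vectors (inherited from `RelIndex d → 𝕜`).
[cite: AdamsBuchholzKoteckyMuller2019, Ch. 6.4 (6.51)] -/
instance : Module ℝ (HamSpace 𝕜 d 𝔥 R n) := inferInstanceAs (Module ℝ (RelIndex d → 𝕜))

/-- `M_0` is finite-dimensional (`|RelIndex d|` coefficients; `45` for `d = 4`).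
[cite: AdamsBuchholzKoteckyMuller2019, Ch. 6.2 (6.22)] -/
instance [Module.Finite ℝ 𝕜] : Module.Finite ℝ (HamSpace 𝕜 d 𝔥 R n) :=
  inferInstanceAs (Module.Finite ℝ (RelIndex d → 𝕜))

/-- The identification with coefficient vectors (the identity).
[cite: AdamsBuchholzKoteckyMuller2019, Ch. 6.4 (6.51)] -/
def toHam : HamSpace 𝕜 d 𝔥 R n ≃ₗ[ℝ] RelevantHamiltonian 𝕜 d := LinearEquiv.refl ℝ _

/-- The inverse identification. [cite: AdamsBuchholzKoteckyMuller2019, Ch. 6.4 (6.51)] -/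
def ofHam : RelevantHamiltonian 𝕜 d ≃ₗ[ℝ] HamSpace 𝕜 d 𝔥 R n := LinearEquiv.refl ℝ _

/-- `toHam (ofHam H) = H`. [cite: AdamsBuchholzKoteckyMuller2019, Ch. 6.4 (6.51)] -/
@[simp] theorem toHam_ofHam (H : RelevantHamiltonian 𝕜 d) :
    toHam (ofHam H : HamSpace 𝕜 d 𝔥 R n) = H := rfl

/-- `ofHam (toHam H) = H`. [cite: AdamsBuchholzKoteckyMuller2019, Ch. 6.4 (6.51)] -/
@[simp] theorem ofHam_toHam (H : HamSpace 𝕜 d 𝔥 R n) : (ofHam (toHam H) : HamSpace 𝕜 d 𝔥 R n) = H := rfl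

variable [Fact (0 < 𝔥)] [Fact (0 < R)] [Fact (0 < n)]

/-- The `AddGroupNorm` structure of `‖·‖_{k,0}` on the synonym.
[cite: AdamsBuchholzKoteckyMuller2019, Ch. 6.4 (6.51)] -/
def groupNorm : AddGroupNorm (HamSpace 𝕜 d 𝔥 R n) where
  toFun H := hamNorm 𝔥 R n (toHam H)
  map_zero' := hamNorm_zero 𝔥 R n
  add_le' H H' := hamNorm_add_le (Fact.out : 0 < 𝔥).le (Fact.out : 0 < R).le n (toHam H) (toHam H')
  neg' H := by
    show hamNorm 𝔥 R n (-(toHam H)) = hamNorm 𝔥 R n (toHam H)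
    unfold hamNorm; simp only [Pi.neg_apply, norm_neg]
  eq_zero_of_map_eq_zero' H h :=
    eq_zero_of_hamNorm_eq_zero (𝕜 := 𝕜) Fact.out Fact.out Fact.out h

/-- **`(M_0, ‖·‖_{k,0})` as a normed group.** [cite: AdamsBuchholzKoteckyMuller2019, Ch. 6.4 (6.51)] -/
instance : NormedAddCommGroup (HamSpace 𝕜 d 𝔥 R n) := (groupNorm (𝕜 := 𝕜)).toNormedAddCommGroup

/-- **The norm of the synonym is `‖·‖_{k,0}`.** [cite: AdamsBuchholzKoteckyMuller2019, Ch. 6.4 (6.51)] -/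
theorem norm_def (H : HamSpace 𝕜 d 𝔥 R n) : ‖H‖ = hamNorm 𝔥 R n (toHam H) := rfl

/-- **`(M_0, ‖·‖_{k,0})` as a real normed space.** [cite: AdamsBuchholzKoteckyMuller2019, Ch. 6.4 (6.51)] -/
instance : NormedSpace ℝ (HamSpace 𝕜 d 𝔥 R n) where
  norm_smul_le c H := by
    rw [norm_def, norm_def, Real.norm_eq_abs]
    exact (hamNorm_real_smul 𝔥 R n c (toHam H)).le

/-- `(M_0, ‖·‖_{k,0})` is complete (finite dimension) — the completeness used by the fine tuning of
Ch. 12. [cite: AdamsBuchholzKoteckyMuller2019, Ch. 12 (12.1)] -/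
instance [FiniteDimensional ℝ 𝕜] : CompleteSpace (HamSpace 𝕜 d 𝔥 R n) :=
  FiniteDimensional.complete ℝ (HamSpace 𝕜 d 𝔥 R n)

end HamSpace

/-! ## `A_k` as a continuous linear equivalence -/

/-- `A` commutes with REAL scalars. [cite: AdamsBuchholzKoteckyMuller2019, Theorem 6.8 (A_k is linear)] -/
theorem stepOpA_real_smul (γ : quadIndex d → ℝ) (c : ℝ) (H : RelevantHamiltonian 𝕜 d) :
    stepOpA γ (c • H) = c • stepOpA γ H := by
  funext ι
  rcases ι with u | α | q
  · simp only [stepOpA_const, Pi.smul_apply, smul_add, Finset.smul_sum, smul_comm c (γ _)]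
  · rfl
  · rfl

section Equiv

variable (𝔥 R : ℝ) (n : ℕ) (𝔥' R' : ℝ) (n' : ℕ) [Fact (0 < 𝔥)] [Fact (0 < R)] [Fact (0 < n)]
  [Fact (0 < 𝔥')] [Fact (0 < R')] [Fact (0 < n')]

/-- `A_k^{(q)}` as a linear equivalence between the coefficient spaces of scales `k` and `k+1`
(inverse `stepOpAInv`). [cite: AdamsBuchholzKoteckyMuller2019, Theorem 6.8 (6.56)] -/
def stepOpALinearEquiv (γ : quadIndex d → ℝ) : HamSpace 𝕜 d 𝔥 R n ≃ₗ[ℝ] HamSpace 𝕜 d 𝔥' R' n' where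
  toFun H := HamSpace.ofHam (stepOpA γ (HamSpace.toHam H))
  invFun H' := HamSpace.ofHam (stepOpAInv γ (HamSpace.toHam H'))
  map_add' H H' := by
    show HamSpace.ofHam (stepOpA γ (HamSpace.toHam H + HamSpace.toHam H')) = _
    rw [stepOpA_add]; rfl
  map_smul' c H := by
    show HamSpace.ofHam (stepOpA γ (c • HamSpace.toHam H)) = _
    rw [stepOpA_real_smul]; rfl
  left_inv H := by
    show HamSpace.ofHam (stepOpAInv γ (stepOpA γ (HamSpace.toHam H))) = H
    rw [stepOpAInv_stepOpA]; rfl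
  right_inv H' := by
    show HamSpace.ofHam (stepOpA γ (stepOpAInv γ (HamSpace.toHam H'))) = H'
    rw [stepOpA_stepOpAInv]; rfl

variable [FiniteDimensional ℝ 𝕜]

/-- **`A_k^{(q)} : (M_0, ‖·‖_{k,0}) ≃L (M_0, ‖·‖_{k+1,0})`** (continuous: finite dimension).
[cite: AdamsBuchholzKoteckyMuller2019, Theorem 6.8 (6.56)] -/
def stepOpAEquiv (γ : quadIndex d → ℝ) : HamSpace 𝕜 d 𝔥 R n ≃L[ℝ] HamSpace 𝕜 d 𝔥' R' n' :=
  (stepOpALinearEquiv (𝕜 := 𝕜) 𝔥 R n 𝔥' R' n' γ).toContinuousLinearEquiv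

/-- `A_k` acts as `stepOpA` on coefficient vectors. [cite: AdamsBuchholzKoteckyMuller2019, Theorem 6.8 (6.56)] -/
theorem toHam_stepOpAEquiv (γ : quadIndex d → ℝ) (H : HamSpace 𝕜 d 𝔥 R n) :
    HamSpace.toHam (stepOpAEquiv (𝕜 := 𝕜) 𝔥 R n 𝔥' R' n' γ H) = stepOpA γ (HamSpace.toHam H) := by
  show HamSpace.toHam ((stepOpALinearEquiv (𝕜 := 𝕜) 𝔥 R n 𝔥' R' n' γ).toContinuousLinearEquiv H) = _
  rw [LinearEquiv.coe_toContinuousLinearEquiv']; rfl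

/-- `A_k⁻¹` acts as `stepOpAInv` on coefficient vectors. [cite: AdamsBuchholzKoteckyMuller2019, Lemma 10.5] -/
theorem toHam_stepOpAEquiv_symm (γ : quadIndex d → ℝ) (H' : HamSpace 𝕜 d 𝔥' R' n') :
    HamSpace.toHam ((stepOpAEquiv (𝕜 := 𝕜) 𝔥 R n 𝔥' R' n' γ).symm H') =
      stepOpAInv γ (HamSpace.toHam H') := by
  show HamSpace.toHam ((stepOpALinearEquiv (𝕜 := 𝕜) 𝔥 R n 𝔥' R' n' γ).toContinuousLinearEquiv.symm H') = _
  rw [LinearEquiv.coe_toContinuousLinearEquiv_symm']; rfl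

/-- **Lemma 10.5 in operator form: `‖A_k⁻¹ H'‖_{k,0} ≤ ¾ ‖H'‖_{k+1,0}`** under the weight relations
of `hamNorm_stepOpAInv_le` (each scale-`k` weight at most half the scale-`(k+1)` weight, and the
shift `γ` small). [cite: AdamsBuchholzKoteckyMuller2019, Lemma 10.5] -/
theorem norm_stepOpAEquiv_symm_le [NormOneClass 𝕜] (γ : quadIndex d → ℝ)
    (hc : (n : ℝ) ≤ (1 / 2 : ℝ) * n')
    (hl : ∀ α : linIndex d, (n : ℝ) * (𝔥 * (R ^ (∑ i, (α : Fin d → ℕ) i))⁻¹) ≤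
      (1 / 2 : ℝ) * (n' * (𝔥' * (R' ^ (∑ i, (α : Fin d → ℕ) i))⁻¹)))
    (hq : (n : ℝ) * (𝔥 / R) ^ 2 ≤ (1 / 2 : ℝ) * (n' * (𝔥' / R') ^ 2))
    (hγ : ∀ q, (n : ℝ) * |γ q| ≤ (1 / 4 : ℝ) * (n' * (𝔥' / R') ^ 2))
    (H' : HamSpace 𝕜 d 𝔥' R' n') :
    ‖(stepOpAEquiv (𝕜 := 𝕜) 𝔥 R n 𝔥' R' n' γ).symm H'‖ ≤ (3 / 4 : ℝ) * ‖H'‖ := by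
  rw [HamSpace.norm_def, HamSpace.norm_def, toHam_stepOpAEquiv_symm]
  exact hamNorm_stepOpAInv_le (Fact.out : 0 < 𝔥').le (Fact.out : 0 < R').le hc hl hq hγ _

end Equiv

end Literature.MathematicalPhysics.StatisticalMechanics.GradientRG

end
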